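import Summits.CriticalPhenomena.Ising3DConformalLimit.Theses.EnergyNotSigmaSquared
import Literature.Probability.LatticeModels.CriticalCorrWellDefined
import Literature.Probability.LatticeModels.PlusStateFKG
import Literature.Probability.LatticeModels.IsingFKG
import Literature.Probability.LatticeModels.Sweep1

/-!
# `MoebiusLimit` (item stmt-CriticalPhenomena-1344): translation invariance of the limit is AUTOMATIC

Structural knowledge about the crux `…Theses.EnergyNotSigmaSquared.MoebiusLimit`
(= `PerfectScreening.MoebiusLimitExists`), standing crux disprover (D-0016); THEOREM-ONLY.

For ANY pointwise scaling limit `S` of the critical correlators on `ℤ³` (any renormalisation `ρ`,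
no non-degeneracy, no symmetry assumed): `S_n(x + v) = S_n(x)` for every `v ∈ ℝ³` and every
non-coincident `x` (`limit_translate`), hence the normalised limit is `IsTranslationInvariant`
(`isTranslationInvariant_normalised_of_limit`). Mechanism: along the meshes `δ_k = t/(k+1)` the
translation by `t·m̂` (`m ∈ ℤ³`) moves every lattice approximation by the SAME lattice vector
`(k+1)m` (`⌊a + (k+1)mⱼ⌋ = ⌊a⌋ + (k+1)mⱼ`), the plus state at `β_c` is translation invariant
(`criticalCorr_translate`, Friedli–Velenik Thm 3.17 via the tree's
`plusExpect_spinProduct_comp_shift`), and a general `v` is the composite of three axis translations.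
So the clause `IsTranslationInvariant` inside `IsMoebiusCovariant` carries no content for a limit.
-/

noncomputable section

namespace Summit.CriticalPhenomena.Ising3DConformalLimit.MoebiusLimitExistsNegative

open Literature.Probability.LatticeModels Filter Set
open scoped Topology

variable {ρ : ℝ → ℝ} {S : CorrFamily 3}

/-! ### Translation invariance of the critical correlators on `ℤ³` -/

/-- **`⟨∏ σ_{yᵢ+v}⟩_{β_c} = ⟨∏ σ_{yᵢ}⟩_{β_c}`** (Friedli–Velenik 2017, Thm. 3.17, through the tree's
`plusExpect_spinProduct_comp_shift` and `ising_fkg_holds`; multiplicities allowed).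
[cite: FriedliVelenik2017, Thm. 3.17] -/
theorem criticalCorr_translate {n : ℕ} (y : Fin n → Site 3) (v : Site 3) :
    criticalCorr 3 n (fun i => y i + v) = criticalCorr 3 n y := by
  classical
  obtain ⟨A, hA⟩ := exists_spinMonomial_eq_spinProduct y
  have hshift : spinMonomial (fun i => y i + v) = spinProduct A ∘ ⇑(configShift (-v)) := by
    funext s
    have h1 : spinMonomial (fun i => y i + v) s = spinMonomial y (configShift (-v) s) := by
      simp [spinMonomial, spinAt, sub_neg_eq_add]
    rw [h1, Function.comp_apply, ← hA]
  show plusExpect 3 (criticalBeta 3) 0 (spinMonomial fun i => y i + v) =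
    plusExpect 3 (criticalBeta 3) 0 (spinMonomial y)
  rw [hshift, hA]
  exact plusExpect_spinProduct_comp_shift (fun β => ising_fkg_holds (zdGraph 3) (β := β))
    (criticalBeta_nonneg 3) 0 A (-v)

/-! ### Lattice approximations under translation by mesh-multiples of lattice vectors -/

/-- `[ (p + (kδ)·m̂) / δ ] = [p/δ] + k·m` for `δ > 0`, `m ∈ ℤ³`, `k ∈ ℕ`. [folklore] -/
theorem latticeApprox_add_natMul_smul {δ : ℝ} (hδ : 0 < δ) (p : EuclideanSpace ℝ (Fin 3))
    (m : Site 3) (k : ℕ) :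
    latticeApprox δ (p + ((k:ℝ) * δ) • siteVec m) = latticeApprox δ p + (k:ℤ) • m := by
  funext j
  simp only [latticeApprox_apply, PiLp.add_apply, PiLp.smul_apply, siteVec_apply, smul_eq_mul,
    Pi.add_apply, Pi.smul_apply]
  have h : (p j + (k:ℝ) * δ * (m j : ℝ)) / δ = p j / δ + (((k:ℤ) * m j : ℤ) : ℝ) := by
    push_cast
    field_simp
  rw [h, Int.floor_add_intCast]

/-- Translation preserves non-coincidence. [folklore] -/
theorem add_mem_nonCoincident_iff {n : ℕ} (v : EuclideanSpace ℝ (Fin 3))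
    (x : Fin n → EuclideanSpace ℝ (Fin 3)) :
    (fun i => x i + v) ∈ NonCoincident 3 n ↔ x ∈ NonCoincident 3 n := by
  rw [mem_nonCoincident, mem_nonCoincident]
  exact (add_left_injective v).of_comp_iff x

/-- The meshes `δ_k = t/(k+1) → 0⁺` for `t > 0`. [folklore] -/
theorem tendsto_div_succ_nhdsGT {t : ℝ} (ht : 0 < t) :
    Tendsto (fun k : ℕ => t / ((k:ℝ) + 1)) atTop (𝓝[>] (0:ℝ)) := by
  refine tendsto_nhdsWithin_iff.2 ⟨?_, Filter.Eventually.of_forall fun k => ?_⟩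
  swap
  · show 0 < t / ((k:ℝ) + 1); positivity
  have h1 : Tendsto (fun k : ℕ => (k:ℝ) + 1) atTop atTop :=
    tendsto_natCast_atTop_atTop.atTop_add tendsto_const_nhds
  exact tendsto_const_nhds.div_atTop h1

/-! ### Translation invariance of any pointwise limit -/

/-- Translation by `t·m̂`, `t > 0`, `m ∈ ℤ³`: `S_n(x + t m̂) = S_n(x)` on `NonCoincident`. [folklore] -/
theorem limit_translate_pos (hlim : HasPointwiseScalingLimit (criticalCorr 3) ρ S) {n : ℕ}
    {x : Fin n → EuclideanSpace ℝ (Fin 3)} (hx : x ∈ NonCoincident 3 n) (m : Site 3) {t : ℝ}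
    (ht : 0 < t) :
    S n (fun i => x i + t • siteVec m) = S n x := by
  have hxv : (fun i => x i + t • siteVec m) ∈ NonCoincident 3 n := (add_mem_nonCoincident_iff _ x).2 hx
  have h1 := ((hlim n).tendsto_at hxv).comp (tendsto_div_succ_nhdsGT ht)
  have h2 := ((hlim n).tendsto_at hx).comp (tendsto_div_succ_nhdsGT ht)
  refine tendsto_nhds_unique h1 (h2.congr fun k => ?_)
  simp only [Function.comp_apply]
  rw [rescaledCorrelator_apply, rescaledCorrelator_apply]
  congr 1
  have hδ : 0 < t / ((k:ℝ) + 1) := by positivity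
  have hcfg : (fun i => latticeApprox (t / ((k:ℝ) + 1)) (x i + t • siteVec m)) =
      fun i => latticeApprox (t / ((k:ℝ) + 1)) (x i) + ((k + 1 : ℕ) : ℤ) • m := by
    funext i
    have h := latticeApprox_add_natMul_smul hδ (x i) m (k + 1)
    have ht' : (((k + 1 : ℕ) : ℝ) * (t / ((k:ℝ) + 1))) = t := by
      push_cast
      field_simp
    rw [ht'] at h
    exact h
  rw [hcfg]
  exact (criticalCorr_translate _ _).symm

/-- Translation by any real multiple of a lattice vector. [folklore] -/
theorem limit_translate_smul_siteVec (hlim : HasPointwiseScalingLimit (criticalCorr 3) ρ S) {n : ℕ}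
    {x : Fin n → EuclideanSpace ℝ (Fin 3)} (hx : x ∈ NonCoincident 3 n) (m : Site 3) (t : ℝ) :
    S n (fun i => x i + t • siteVec m) = S n x := by
  rcases lt_trichotomy t 0 with ht | rfl | ht
  · have h : t • siteVec m = (-t) • siteVec (-m) := by
      ext j; simp [siteVec_apply]
    rw [h]
    exact limit_translate_pos hlim hx (-m) (by linarith)
  · simp
  · exact limit_translate_pos hlim hx m ht

/-- **Any pointwise scaling limit of the critical correlators on `ℤ³` is translation invariant on
non-coincident configurations** (every `v ∈ ℝ³` is the composite of three axis translations).
[cite: FriedliVelenik2017, Thm. 3.17] -/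
theorem limit_translate (hlim : HasPointwiseScalingLimit (criticalCorr 3) ρ S) {n : ℕ}
    (v : EuclideanSpace ℝ (Fin 3)) {x : Fin n → EuclideanSpace ℝ (Fin 3)}
    (hx : x ∈ NonCoincident 3 n) :
    S n (fun i => x i + v) = S n x := by
  set a : EuclideanSpace ℝ (Fin 3) := v 0 • siteVec (Pi.single 0 1 : Site 3) with ha
  set b : EuclideanSpace ℝ (Fin 3) := v 1 • siteVec (Pi.single 1 1 : Site 3) with hb
  set c : EuclideanSpace ℝ (Fin 3) := v 2 • siteVec (Pi.single 2 1 : Site 3) with hc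
  have hv : v = a + b + c := by
    ext j
    fin_cases j <;> simp [ha, hb, hc, siteVec_apply]
  have hxa : (fun i => x i + a) ∈ NonCoincident 3 n := (add_mem_nonCoincident_iff _ _).2 hx
  have hxab : (fun i => (x i + a) + b) ∈ NonCoincident 3 n := (add_mem_nonCoincident_iff _ _).2 hxa
  have hcfg : (fun i => x i + v) = fun i => ((x i + a) + b) + c := by
    funext i; rw [hv]; abel
  rw [hcfg, limit_translate_smul_siteVec hlim hxab _ _, limit_translate_smul_siteVec hlim hxa _ _,
    limit_translate_smul_siteVec hlim hx _ _]

open Classical in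
/-- **The normalised limit is translation invariant** — for ANY pointwise limit of the critical
correlators, with no further hypothesis: the clause `IsTranslationInvariant` (first half of
`IsEuclideanInvariant` inside `IsMoebiusCovariant`) carries no content for a scaling limit.
[cite: FriedliVelenik2017, Thm. 3.17] -/
theorem isTranslationInvariant_normalised_of_limit
    (hlim : HasPointwiseScalingLimit (criticalCorr 3) ρ S) :
    IsTranslationInvariant (fun n x => if x ∈ NonCoincident 3 n then S n x else 0) := by
  intro n v x
  by_cases hx : x ∈ NonCoincident 3 n
  · simp only [if_pos ((add_mem_nonCoincident_iff v x).2 hx), if_pos hx, limit_translate hlim v hx]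
  · simp only [if_neg (mt (add_mem_nonCoincident_iff v x).1 hx), if_neg hx]

/-- The two-point function of any pointwise limit is a function of the difference only:
`S₂(p, q) = S₂(0, q − p)` for `p ≠ q`. [folklore] -/
theorem limit_two_eq_of_sub (hlim : HasPointwiseScalingLimit (criticalCorr 3) ρ S)
    {p q : EuclideanSpace ℝ (Fin 3)} (hpq : p ≠ q) :
    S 2 ![p, q] = S 2 ![0, q - p] := by
  have hmem : (![0, q - p] : Fin 2 → EuclideanSpace ℝ (Fin 3)) ∈ NonCoincident 3 2 := by
    rw [mem_nonCoincident]
    intro i j hij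
    fin_cases i <;> fin_cases j
    · rfl
    · exfalso; exact hpq (eq_of_sub_eq_zero (by simpa using hij.symm)).symm
    · exfalso; exact hpq (eq_of_sub_eq_zero (by simpa using hij)).symm
    · rfl
  have h := limit_translate hlim p hmem
  have hcfg : (fun i => (![0, q - p] : Fin 2 → EuclideanSpace ℝ (Fin 3)) i + p) = ![p, q] := by
    funext i; fin_cases i <;> simp
  rw [hcfg] at h
  exact h

end Summit.CriticalPhenomena.Ising3DConformalLimit.MoebiusLimitExistsNegative

end
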